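import Literature.Computability.AlgebraicComplexity.KV20TensorRankEquationsProofs
import Mathlib.FieldTheory.IsAlgClosed.AlgebraicClosure
import HarnessLib

/-!
# Kumar–Volk 2020/2022, §4: the universal map for small linear circuits — PROOFS of the typed
# facts `kumarVolk2020_lem_4_1` (Lemma 4.1) and `kumarVolk2020_thm_1_2` (Theorem 1.2)

Topic: `Literature/Computability/AlgebraicComplexity`. Source: M. Kumar, B. L. Volk, *A polynomial
degree bound on equations for non-rigid matrices and small linear circuits*, ACM TOCT 14(2) (2022)
art. 6 = arXiv:2003.12938 [KumarVolk2022], §4 (journal numbering; arXiv §3, Lemma 8 / Thm 2), as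
typed by x5 in `KV20LinearCircuitEquations.lean` (the layered model `LinCircuit` of linear
circuits with `n` output sinks, `HasLinCircuit`, `smallLinCircuitSet`). This file discharges the two
named facts of that file's §4 by the printed proof; the facts of §5 (Thm 5.5, Thm 1.4) are
discharged in `KV20TensorRankEquationsProofs.lean`, Lemmas 5.4/5.6 in the statement file itself.

## The printed proof ([tex p0006], journal §4.1–§4.2) and its rendering

* **The universal graph and the universal map** ("`G` has a set `V_0` of `n` input nodes … a set
  `V_{s+1}` of `n` designated output nodes … `s` disjoint sets of vertices `V_1, …, V_s` … Each
  vertex … has as its children all vertices `u ∈ V_j` for all `0 ≤ j < i` … Let `s' ≤ s⁴` be the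
  number of edges … The edge `e_i` is labeled by the `i`-th coordinate of the map `SV_{s',s}(x, y)`
  given in Lemma 3.1 … the `(i,j)`-th entry of the matrix `U(x, y)` … is given by the sum, over
  all paths from `X_i` to the `j`-th output node, of the product of the edge labels on that path").
  In the tree's model a linear circuit IS layered (gates `0, …, m-1` topologically numbered, edges
  only from inputs and earlier gates, `n` output sinks), so the universal circuit for size `s` is
  taken with `s` gate SLOTS `0, …, s-1`, every slot having an edge slot from every input and every
  earlier slot, and every output node an edge slot from every input and every gate slot:
  `KumarVolk2020.USlot n s` (`s' = sn + s² + n(n+s)` edge slots, `≤ 4s² ≤ s⁴` for `2 ≤ s`,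
  `n ≤ s` — `KumarVolk2020.card_uSlot_le_pow_four`; a smaller universal graph than print's `s²`
  internal vertices, with the same two properties: every size-`≤ s` circuit embeds, and paths have
  length `≤ s + 1`). Its valuation with arbitrary edge labels `L : USlot n s → R` over any
  commutative semiring is `KumarVolk2020.ucVal` (defining equations `KumarVolk2020.ucVal_eq`), the
  computed matrix `KumarVolk2020.ucOut`; ring homomorphisms commute with both
  (`KumarVolk2020.map_ucOut` — "under this labeling of the edges, the circuit `G` computes …"),
  and with labels of degree `≤ d` the entries have degree `≤ d(s+1)`
  (`KumarVolk2020.totalDegree_ucOut_le` — "each edge label in `G` is a polynomial of degree `s'`,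
  and each path is of length at most `s+1`"). The universal map is `KumarVolk2020.universalMap a`
  (labels = `KumarVolk2020.svMap a s`, the Shpilka–Volkovich map of Lemma 3.1 PROVED in
  `KV20NonRigidEquationsProofs.lean`, at distinct nodes `a : USlot n s ↪ K`), of degree
  `≤ s'(s+1)` (`KumarVolk2020.totalDegree_universalMap_le`).
* **Embedding** ("every directed acyclic graph with `s` edges (and hence at most `s` vertices …)
  can be (perhaps non-uniquely) embedded in `G` as a subgraph"): a circuit of size `≤ s` with any
  number `m` of gates has at most `size ≤ s` gates with a nonzero incoming edge; the others compute
  `0`; keeping the former in their order and padding with edge-less gates gives a circuit with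
  EXACTLY `s` gates, no larger size, computing the same matrix —
  `LinCircuit.restrictGates`, `LinCircuit.exists_normalForm`. The labels of an `s`-gate circuit,
  as a labelling of the slots (`KumarVolk2020.labels`), make the universal circuit compute the
  circuit's matrix (`KumarVolk2020.ucOut_labels_eq` — "Observe that under this labeling of the
  edges, the circuit `G` computes the same transformation as the circuit `C`"), and exactly
  `size ≤ s` of them are nonzero (`KumarVolk2020.card_labels_ne_zero`).
* **The SV step** ("it is possible to set the tuple of variables `y` to field elements
  `α_1, …, α_s` such that the `j`-th coordinate of `SV(x, α)` equals `β_i` if `j = i_k` … [and] `0`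
  otherwise … Hence `U(x, α) = A`"): `KumarVolk2020.exists_eval_svMap_eq` (support padded to size
  exactly `s` by `Finset.exists_superset_card_eq`, then `eval_svMap_apply` /
  `eval_svMap_of_not_mem_range`), `KumarVolk2020.ucOut_mem_polyMapImage_universalMap`,
  `KumarVolk2020.smallLinCircuitSet_subset_polyMapImage_universalMap`. Whence
  `kumarVolk2020_lem_4_1_holds` (nodes from the fact's `s⁴ + 1` distinct field elements; the
  fact's `4 ≤ s` is used only as `2 ≤ s`).
* **Theorem 1.2** (journal §4.2: "`V_1` … polynomials … in `n²` variables of degree at most `n³` …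
  Let `U` be the map given by Lemma 4.1 for `s = n²/200` … `dim(V_1) = binom(n³+n², n²) ≥ n^{n²}`,
  whereas `dim(V_2) … < dim(V_1)` … By Lemma 4.1, if `A` has a circuit of size `n²/200`, it is in
  the image of `U`, so that `Q_0(A) = 0`"): Lemma 2.1 (`KumarVolk2020.exists_isEquationFor_polyMapImage`,
  `KV20NonRigidEquationsProofs.lean`) for `universalMap` with `N = n²`, `K = 2s`,
  `D = s'(s+1)`, `Δ = n³`, and the exact count `KumarVolk2020.thm_1_2_count`
  (`binom(2s + Dn³, 2s) ≤ (Dn³+1)^{2s} ≤ (n+1)^{26 s} < (n+1)^{n²} ≤ binom(n²+n³, n²)`, valid for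
  every `n ≥ 1`, so the fact's `n₀` is `1`). PRINT-READING NOTE: the theorem is stated for "`F` of
  size at least `n²`", but the printed proof needs the `s' ≤ n⁸` Lagrange nodes of `SV_{s',s}`
  (Lemma 3.1: `|F| > s'`), i.e. more than `n²` field elements for large `n`. The gap is closed here
  in the standard way: run the argument over the algebraic closure `K ⊇ F` (infinite), where an
  `F`-matrix with a small `F`-circuit lies, read in `K`, in the image of `U`
  (`KumarVolk2020.exists_labels_of_mem_smallLinCircuitSet` + `map_ucOut` along `algebraMap F K`),
  and DESCEND the equation to `F` coefficientwise along an `F`-basis of `K`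
  (`KumarVolk2020.exists_isEquationFor_of_extension`, folklore). So `kumarVolk2020_thm_1_2_holds`
  does not use the typed field-size hypothesis; nothing is weakened.

Honest framing (val-lit): discharges of published, proved statements (net named-fact debt `−2`,
no new facts); nothing here bears on `VP ≠ VNP`.

## References

* [KumarVolk2022] M. Kumar, B. L. Volk, ACM TOCT 14(2) (2022) art. 6, doi:10.1145/3543685,
  arXiv:2003.12938 — §4.1 (universal graph, Lemma 4.1 = arXiv Lemma 8), §4.2 (Thm 1.2 = arXiv Thm 2).
* [SV15] A. Shpilka, I. Volkovich, Comput. Complexity 24 (2015) — the map of Lemma 3.1.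
-/

noncomputable section

open MvPolynomial

namespace Literature.Computability.AlgebraicComplexity

namespace KumarVolk2020

/-! ### The universal circuit: edge slots, generic valuation, ring-hom transport, degree -/

/-- **Edge slots of the universal circuit for size `s`** (KV §4.1 "universal graph `G` for size
`s`"), in the tree's layered normal form of linear circuits with `s` gate slots `0, …, s-1` and `n`
output nodes: a slot is an edge `X_i → t` (`inl (t, i)`), an edge `t' → t` between gate slots
(`inr (inl (t, t'))`, used only for `t' < t`), or an edge into output node `j` from input `i` /
gate slot `t` (`inr (inr (j, u))`). [cite: KumarVolk2022, §4.1] -/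
abbrev USlot (n s : ℕ) : Type := (Fin s × Fin n) ⊕ ((Fin s × Fin s) ⊕ (Fin n × (Fin n ⊕ Fin s)))

/-- `|USlot n s| = sn + s² + n(n+s)` (the universal circuit's number of edge slots, print's `s'`).
[cite: KumarVolk2022, §4.1] -/
theorem card_uSlot (n s : ℕ) : Fintype.card (USlot n s) = s * n + (s * s + n * (n + s)) := by
  simp only [USlot, Fintype.card_sum, Fintype.card_prod, Fintype.card_fin]

section Generic

variable {R : Type*} [CommSemiring R] {n s : ℕ}

/-- The valuation of the universal circuit with edge labels `L`, computed with fuel `k`: gate slot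
`t` computes the linear form with coefficient of `X_i` equal to
`L(X_i → t) + Σ_{t' < t} L(t' → t) · (value of t')` (KV §1.3 "defined inductively").
[cite: KumarVolk2022, §4.1] -/
def ucValN (L : USlot n s → R) : ℕ → Fin s → Fin n → R
  | 0 => fun _ _ => 0
  | k + 1 => fun t i => L (Sum.inl (t, i)) +
      ∑ t' : Fin s, if t' < t then L (Sum.inr (Sum.inl (t, t'))) * ucValN L k t' i else 0

/-- The valuation of the universal circuit with edge labels `L` (fuel `s` suffices: slot `t` only
depends on slots `< t`). [cite: KumarVolk2022, §4.1] -/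
def ucVal (L : USlot n s → R) : Fin s → Fin n → R := ucValN L s

/-- The matrix computed by the universal circuit with edge labels `L`: output node `j` has the edge
from `X_i` labelled `L(X_i → out_j)` and the edges from the gate slots `t` labelled `L(t → out_j)`;
entry `(j, i)` = coefficient of `X_i` in output `j` (= print's "sum over all paths from `X_i` to the
`j`-th output node of the product of the edge labels"). [cite: KumarVolk2022, §4.1] -/
def ucOut (L : USlot n s → R) (j i : Fin n) : R :=
  L (Sum.inr (Sum.inr (j, Sum.inl i))) + ∑ t : Fin s, L (Sum.inr (Sum.inr (j, Sum.inr t))) * ucVal L t i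

/-- Stability of the fuelled valuation: slot `t` is final after `t + 1` rounds.
[cite: KumarVolk2022, §4.1] -/
theorem ucValN_succ_eq (L : USlot n s → R) :
    ∀ (k : ℕ) (t : Fin s), t.val < k → ∀ i, ucValN L (k + 1) t i = ucValN L k t i := by
  intro k
  induction k with
  | zero => intro t ht; exact absurd ht (Nat.not_lt_zero _)
  | succ k ih =>
    intro t ht i
    change L (Sum.inl (t, i)) + ∑ t' : Fin s,
        (if t' < t then L (Sum.inr (Sum.inl (t, t'))) * ucValN L (k + 1) t' i else 0) =
      L (Sum.inl (t, i)) + ∑ t' : Fin s,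
        (if t' < t then L (Sum.inr (Sum.inl (t, t'))) * ucValN L k t' i else 0)
    congr 1
    refine Finset.sum_congr rfl fun t' _ => ?_
    split_ifs with h
    · rw [ih t' (lt_of_lt_of_le (Fin.lt_def.1 h) (by omega)) i]
    · rfl

/-- **The defining equations of the universal circuit**:
`val(t)_i = L(X_i → t) + Σ_{t' < t} L(t' → t) · val(t')_i`. [cite: KumarVolk2022, §4.1] -/
theorem ucVal_eq (L : USlot n s → R) (t : Fin s) (i : Fin n) :
    ucVal L t i = L (Sum.inl (t, i)) +
      ∑ t' : Fin s, if t' < t then L (Sum.inr (Sum.inl (t, t'))) * ucVal L t' i else 0 := by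
  unfold ucVal
  rw [← ucValN_succ_eq L s t t.isLt i]
  rfl

variable {R' : Type*} [CommSemiring R']

/-- Ring homomorphisms commute with the fuelled valuation. [cite: KumarVolk2022, §4.1] -/
theorem map_ucValN (f : R →+* R') (L : USlot n s → R) :
    ∀ (k : ℕ) (t : Fin s) (i : Fin n), f (ucValN L k t i) = ucValN (fun e => f (L e)) k t i := by
  intro k
  induction k with
  | zero => intro t i; exact map_zero f
  | succ k ih =>
    intro t i
    change f (L (Sum.inl (t, i)) + ∑ t' : Fin s,
        (if t' < t then L (Sum.inr (Sum.inl (t, t'))) * ucValN L k t' i else 0)) =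
      f (L (Sum.inl (t, i))) + ∑ t' : Fin s,
        (if t' < t then f (L (Sum.inr (Sum.inl (t, t')))) * ucValN (fun e => f (L e)) k t' i else 0)
    rw [map_add, map_sum]
    congr 1
    refine Finset.sum_congr rfl fun t' _ => ?_
    split_ifs with h
    · rw [map_mul, ih]
    · exact map_zero f

/-- Ring homomorphisms commute with the valuation (e.g. evaluation of the generic labels at a
point: "under this labeling of the edges, the circuit `G` computes …"). [cite: KumarVolk2022, §4.1] -/
theorem map_ucVal (f : R →+* R') (L : USlot n s → R) (t : Fin s) (i : Fin n) :
    f (ucVal L t i) = ucVal (fun e => f (L e)) t i :=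
  map_ucValN f L s t i

/-- Ring homomorphisms commute with the computed matrix. [cite: KumarVolk2022, §4.1] -/
theorem map_ucOut (f : R →+* R') (L : USlot n s → R) (j i : Fin n) :
    f (ucOut L j i) = ucOut (fun e => f (L e)) j i := by
  unfold ucOut
  rw [map_add, map_sum]
  congr 1
  refine Finset.sum_congr rfl fun t _ => ?_
  rw [map_mul, map_ucVal]

end Generic

section Degree

variable {K : Type*} [CommSemiring K] {σ : Type*} {n s : ℕ}

/-- Degree of the fuelled valuation: if every label has degree `≤ d`, slot `t`'s value has degree
`≤ d (t + 1)` ("each path is of length at most …"). [cite: KumarVolk2022, Lemma 4.1 (proof)] -/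
theorem totalDegree_ucValN_le (L : USlot n s → MvPolynomial σ K) {d : ℕ}
    (hL : ∀ e, (L e).totalDegree ≤ d) :
    ∀ (k : ℕ) (t : Fin s) (i : Fin n), (ucValN L k t i).totalDegree ≤ d * (t.val + 1) := by
  intro k
  induction k with
  | zero => intro t i; change (0 : MvPolynomial σ K).totalDegree ≤ _; rw [totalDegree_zero]; exact Nat.zero_le _
  | succ k ih =>
    intro t i
    change (L (Sum.inl (t, i)) + ∑ t' : Fin s,
        (if t' < t then L (Sum.inr (Sum.inl (t, t'))) * ucValN L k t' i else 0)).totalDegree ≤ _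
    refine (totalDegree_add _ _).trans (max_le ?_ ?_)
    · exact (hL _).trans (Nat.le_mul_of_pos_right _ (Nat.succ_pos _))
    · refine totalDegree_finsetSum_le fun t' _ => ?_
      split_ifs with h
      · refine (totalDegree_mul _ _).trans ?_
        have h1 := hL (Sum.inr (Sum.inl (t, t')))
        have h2 := ih t' i
        have h3 : t'.val + 1 ≤ t.val := Fin.lt_def.1 h
        calc (L (Sum.inr (Sum.inl (t, t')))).totalDegree + (ucValN L k t' i).totalDegree
            ≤ d + d * (t'.val + 1) := Nat.add_le_add h1 h2
          _ ≤ d + d * t.val := Nat.add_le_add_left (Nat.mul_le_mul_left _ h3) _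
          _ = d * (t.val + 1) := by ring
      · rw [totalDegree_zero]; exact Nat.zero_le _

/-- **"The degree of `U` is at most `s'·(s+1)`"**: with labels of degree `≤ d`, every entry of the
computed matrix has degree `≤ d (s + 1)` (label degree `d`, paths of length `≤ s + 1`).
[cite: KumarVolk2022, Lemma 4.1] -/
theorem totalDegree_ucOut_le (L : USlot n s → MvPolynomial σ K) {d : ℕ}
    (hL : ∀ e, (L e).totalDegree ≤ d) (j i : Fin n) :
    (ucOut L j i).totalDegree ≤ d * (s + 1) := by
  unfold ucOut
  refine (totalDegree_add _ _).trans (max_le ?_ ?_)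
  · exact (hL _).trans (Nat.le_mul_of_pos_right _ (Nat.succ_pos _))
  · refine totalDegree_finsetSum_le fun t _ => (totalDegree_mul _ _).trans ?_
    have h1 := hL (Sum.inr (Sum.inr (j, Sum.inr t)))
    have h2 := totalDegree_ucValN_le L hL s t i
    have h3 : t.val + 1 ≤ s := t.isLt
    calc (L (Sum.inr (Sum.inr (j, Sum.inr t)))).totalDegree + (ucVal L t i).totalDegree
        ≤ d + d * (t.val + 1) := Nat.add_le_add h1 h2
      _ ≤ d + d * s := Nat.add_le_add_left (Nat.mul_le_mul_left _ h3) _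
      _ = d * (s + 1) := by ring

end Degree

section ExactGates

variable {F : Type*} [Field F] {n s : ℕ}

/-- The edge labels of a circuit with exactly `s` gates, as a labelling of the universal circuit's
slots (the labelling `β` of print's embedded subgraph: "let `β = (β_1, …, β_s)` be their
corresponding labels in `C`", all other slots labelled `0`). [cite: KumarVolk2022, Lemma 4.1 (proof)] -/
def labels (C : LinCircuit F n s) : USlot n s → F :=
  Sum.elim (fun p => C.inW p.1 p.2) (Sum.elim (fun p => C.gateW p.1 p.2) fun p => C.outW p.1 p.2)

/-- **"Under this labeling of the edges, the circuit `G` computes the same transformation as the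
circuit `C`"**, gate by gate: the universal valuation with `C`'s labels is `C`'s valuation.
[cite: KumarVolk2022, Lemma 4.1 (proof)] -/
theorem ucVal_labels_eq (C : LinCircuit F n s) {v : Fin s → Fin n → F}
    (hv : ∀ g, v g = C.inW g + ∑ g', C.gateW g g' • v g') (t : Fin s) (i : Fin n) :
    ucVal (labels C) t i = v t i := by
  obtain ⟨N, hN⟩ : ∃ N : ℕ, t.val < N := ⟨t.val + 1, Nat.lt_succ_self _⟩
  induction N generalizing t i with
  | zero => exact absurd hN (Nat.not_lt_zero _)
  | succ N ih =>
    rw [ucVal_eq]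
    have hvt : v t i = C.inW t i + ∑ g', C.gateW t g' * v g' i := by
      have := congrFun (hv t) i
      simpa only [Pi.add_apply, Finset.sum_apply, Pi.smul_apply, smul_eq_mul] using this
    rw [hvt]
    change C.inW t i + _ = _
    congr 1
    refine Finset.sum_congr rfl fun t' _ => ?_
    split_ifs with h
    · change C.gateW t t' * ucVal (labels C) t' i = _
      rw [ih t' i (lt_of_lt_of_le (Fin.lt_def.1 h) (Nat.lt_succ_iff.1 hN))]
    · have h0 : C.gateW t t' = 0 := by
        by_contra hne
        exact h (C.acyclic t t' hne)
      rw [h0, zero_mul]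

/-- Hence the universal circuit with `C`'s labels computes `C`'s matrix ("Hence `U(x, α) = A`",
label level). [cite: KumarVolk2022, Lemma 4.1 (proof)] -/
theorem ucOut_labels_eq (C : LinCircuit F n s) {A : Matrix (Fin n) (Fin n) F} (hA : C.Computes A)
    (j i : Fin n) : ucOut (labels C) j i = A j i := by
  obtain ⟨v, hv, hout⟩ := hA
  have hAj : A j i = C.outW j (Sum.inl i) + ∑ g, C.outW j (Sum.inr g) * v g i := by
    have := congrFun (hout j) i
    simpa only [Pi.add_apply, Finset.sum_apply, Pi.smul_apply, smul_eq_mul] using this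
  rw [hAj, ucOut]
  change C.outW j (Sum.inl i) + _ = _
  congr 1
  refine Finset.sum_congr rfl fun t _ => ?_
  change C.outW j (Sum.inr t) * ucVal (labels C) t i = _
  rw [ucVal_labels_eq C hv]

/-- The nonzero labels are exactly the edges of `C`: their number is `C.size`.
[cite: KumarVolk2022, Lemma 4.1 (proof)] -/
theorem card_labels_ne_zero (C : LinCircuit F n s) :
    Nat.card {e : USlot n s // labels C e ≠ 0} = C.size := by
  rw [Nat.card_congr (Equiv.subtypeSum (α := Fin s × Fin n)
      (β := (Fin s × Fin s) ⊕ (Fin n × (Fin n ⊕ Fin s))) (p := fun e => labels C e ≠ 0)),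
    Nat.card_sum,
    Nat.card_congr (Equiv.subtypeSum (α := Fin s × Fin s) (β := Fin n × (Fin n ⊕ Fin s))
      (p := fun e => labels C (Sum.inr e) ≠ 0)),
    Nat.card_sum, LinCircuit.size, Nat.add_assoc]
  rfl

end ExactGates

section NormalForm

variable {F : Type*} [Field F] {n m : ℕ}

omit [Field F] in
/-- A `dite`-label `if h : P then f h else 0` is nonzero only in the `then` branch. [folklore] -/
private theorem exists_of_dite_ne_zero [Zero F] {P : Prop} [Decidable P] {f : P → F}
    (h : (if hp : P then f hp else 0) ≠ 0) : ∃ hp : P, f hp ≠ 0 := by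
  by_cases hp : P
  · exact ⟨hp, by rwa [dif_pos hp] at h⟩
  · rw [dif_neg hp] at h
    exact absurd rfl h

/-- Zero-padded reindexing: a sum over `Fin k` as a sum over the first `k` of `s ≥ k` slots.
[folklore] -/
private theorem sum_fin_dite_eq {M : Type*} [AddCommMonoid M] {k s : ℕ} (hks : k ≤ s) (f : Fin k → M) :
    ∑ t : Fin s, (if h : t.val < k then f ⟨t.val, h⟩ else 0) = ∑ t : Fin k, f t := by
  let g : ℕ → M := fun x => if h : x < k then f ⟨x, h⟩ else 0
  have h1 : ∑ t : Fin s, (if h : t.val < k then f ⟨t.val, h⟩ else 0) = ∑ x ∈ Finset.range s, g x :=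
    Fin.sum_univ_eq_sum_range g s
  have h2 : ∑ t : Fin k, f t = ∑ x ∈ Finset.range k, g x := by
    rw [← Fin.sum_univ_eq_sum_range g k]
    refine Finset.sum_congr rfl fun t _ => ?_
    simp only [g, dif_pos t.isLt]
  rw [h1, h2]
  symm
  refine Finset.sum_subset (Finset.range_subset_range.2 hks) fun x _ hx => ?_
  have : ¬ x < k := fun h => hx (Finset.mem_range.2 h)
  simp only [g, dif_neg this]

/-- **Restriction of a circuit to a sub-family of gates, re-numbered into `s` slots** (print:
"the graph of `C` can be embedded as a subgraph in the graph `G`"): keep the gates `emb 0 < emb 1 <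
⋯ < emb (k-1)` as slots `0, …, k-1` with all their edges among themselves, from the inputs and into
the outputs; slots `≥ k` are edge-less. [cite: KumarVolk2022, Lemma 4.1 (proof)] -/
def _root_.Literature.Computability.AlgebraicComplexity.LinCircuit.restrictGates
    (C : LinCircuit F n m) {k : ℕ} (s : ℕ) (emb : Fin k ↪o Fin m) : LinCircuit F n s where
  inW t i := if h : t.val < k then C.inW (emb ⟨t.val, h⟩) i else 0
  gateW t t' :=
    if h : t.val < k ∧ t'.val < k then C.gateW (emb ⟨t.val, h.1⟩) (emb ⟨t'.val, h.2⟩) else 0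
  acyclic t t' hne := by
    obtain ⟨h, hne'⟩ := exists_of_dite_ne_zero hne
    have hlt : (⟨t'.val, h.2⟩ : Fin k) < ⟨t.val, h.1⟩ := emb.lt_iff_lt.1 (C.acyclic _ _ hne')
    exact Fin.lt_def.2 (Fin.lt_def.1 hlt)
  outW j u := Sum.elim (fun i => C.outW j (Sum.inl i))
    (fun t : Fin s => if h : t.val < k then C.outW j (Sum.inr (emb ⟨t.val, h⟩)) else 0) u

variable (C : LinCircuit F n m) {k : ℕ} (s : ℕ) (emb : Fin k ↪o Fin m)

/-- Input labels of the restriction. [cite: KumarVolk2022, Lemma 4.1 (proof)] -/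
theorem restrictGates_inW (t : Fin s) (i : Fin n) : (C.restrictGates s emb).inW t i =
    if h : t.val < k then C.inW (emb ⟨t.val, h⟩) i else 0 := rfl

/-- Gate-to-gate labels of the restriction. [cite: KumarVolk2022, Lemma 4.1 (proof)] -/
theorem restrictGates_gateW (t t' : Fin s) : (C.restrictGates s emb).gateW t t' =
    if h : t.val < k ∧ t'.val < k then C.gateW (emb ⟨t.val, h.1⟩) (emb ⟨t'.val, h.2⟩) else 0 := rfl

/-- Input-to-output labels of the restriction. [cite: KumarVolk2022, Lemma 4.1 (proof)] -/
theorem restrictGates_outW_inl (j i : Fin n) :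
    (C.restrictGates s emb).outW j (Sum.inl i) = C.outW j (Sum.inl i) := rfl

/-- Gate-to-output labels of the restriction. [cite: KumarVolk2022, Lemma 4.1 (proof)] -/
theorem restrictGates_outW_inr (j : Fin n) (t : Fin s) : (C.restrictGates s emb).outW j (Sum.inr t) =
    if h : t.val < k then C.outW j (Sum.inr (emb ⟨t.val, h⟩)) else 0 := rfl

/-- The restriction has no more edges than `C` (each of its edges is an edge of `C`).
[cite: KumarVolk2022, Lemma 4.1 (proof)] -/
theorem size_restrictGates_le : (C.restrictGates s emb).size ≤ C.size := by
  unfold LinCircuit.size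
  refine Nat.add_le_add (Nat.add_le_add ?_ ?_) ?_
  · -- edges from the inputs
    let φ : {p : Fin s × Fin n // (C.restrictGates s emb).inW p.1 p.2 ≠ 0} →
        {p : Fin m × Fin n // C.inW p.1 p.2 ≠ 0} := fun p =>
      ⟨(emb ⟨p.1.1.val, (exists_of_dite_ne_zero p.2).fst⟩, p.1.2), (exists_of_dite_ne_zero p.2).snd⟩
    refine Nat.card_le_card_of_injective φ fun p q h => ?_
    have h1 := congrArg (fun r => (r.1.1, r.1.2)) h
    simp only [φ, Prod.mk.injEq] at h1
    obtain ⟨h11, h12⟩ := h1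
    have h13 := congrArg Fin.val (emb.injective h11)
    exact Subtype.ext (Prod.ext (Fin.ext h13) h12)
  · -- edges between gates
    let φ : {p : Fin s × Fin s // (C.restrictGates s emb).gateW p.1 p.2 ≠ 0} →
        {p : Fin m × Fin m // C.gateW p.1 p.2 ≠ 0} := fun p =>
      ⟨(emb ⟨p.1.1.val, (exists_of_dite_ne_zero p.2).fst.1⟩,
        emb ⟨p.1.2.val, (exists_of_dite_ne_zero p.2).fst.2⟩), (exists_of_dite_ne_zero p.2).snd⟩
    refine Nat.card_le_card_of_injective φ fun p q h => ?_
    have h1 := congrArg (fun r => (r.1.1, r.1.2)) h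
    simp only [φ, Prod.mk.injEq] at h1
    obtain ⟨h11, h12⟩ := h1
    have h13 := congrArg Fin.val (emb.injective h11)
    have h14 := congrArg Fin.val (emb.injective h12)
    exact Subtype.ext (Prod.ext (Fin.ext h13) (Fin.ext h14))
  · -- edges into the outputs
    let ψ : Fin n × (Fin n ⊕ Fin s) → Fin n × (Fin n ⊕ Fin m) := fun p =>
      (p.1, Sum.elim (fun i => Sum.inl i)
        (fun t : Fin s => if h : t.val < k then Sum.inr (emb ⟨t.val, h⟩) else Sum.inl p.1) p.2)
    have hψ : ∀ p : Fin n × (Fin n ⊕ Fin s), (C.restrictGates s emb).outW p.1 p.2 ≠ 0 →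
        C.outW (ψ p).1 (ψ p).2 ≠ 0 := by
      rintro ⟨j, u⟩ hne
      rcases u with i | t
      · exact hne
      · obtain ⟨h, hne'⟩ := exists_of_dite_ne_zero hne
        simp only [ψ, Sum.elim_inr, dif_pos h]
        exact hne'
    let φ : {p : Fin n × (Fin n ⊕ Fin s) // (C.restrictGates s emb).outW p.1 p.2 ≠ 0} →
        {p : Fin n × (Fin n ⊕ Fin m) // C.outW p.1 p.2 ≠ 0} := fun p => ⟨ψ p.1, hψ p.1 p.2⟩
    refine Nat.card_le_card_of_injective φ fun p q h => ?_
    have h1 : ψ p.1 = ψ q.1 := congrArg Subtype.val h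
    obtain ⟨⟨j, u⟩, hp⟩ := p
    obtain ⟨⟨j', u'⟩, hq⟩ := q
    simp only [ψ, Prod.mk.injEq] at h1
    obtain ⟨hjj, huu⟩ := h1
    subst hjj
    refine Subtype.ext (Prod.ext rfl ?_)
    change u = u'
    rcases u with i | t <;> rcases u' with i' | t'
    · simpa using huu
    · obtain ⟨h, _⟩ := exists_of_dite_ne_zero hq
      rw [Sum.elim_inl, Sum.elim_inr, dif_pos h] at huu
      exact absurd huu Sum.inl_ne_inr
    · obtain ⟨h, _⟩ := exists_of_dite_ne_zero hp
      rw [Sum.elim_inl, Sum.elim_inr, dif_pos h] at huu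
      exact absurd huu Sum.inr_ne_inl
    · obtain ⟨h, _⟩ := exists_of_dite_ne_zero hp
      obtain ⟨h', _⟩ := exists_of_dite_ne_zero hq
      rw [Sum.elim_inr, Sum.elim_inr, dif_pos h, dif_pos h'] at huu
      have := congrArg Fin.val (emb.injective (Sum.inr_injective huu))
      exact congrArg Sum.inr (Fin.ext this)

/-- The restriction computes the same matrix, provided every gate outside the kept family has no
incoming edge (so computes `0`) and all kept gates fit into the `s` slots (`k ≤ s`).
[cite: KumarVolk2022, Lemma 4.1 (proof)] -/
theorem restrictGates_computes (hks : k ≤ s)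
    (hout : ∀ g, g ∉ Set.range emb → (∀ i, C.inW g i = 0) ∧ ∀ g', C.gateW g g' = 0)
    {A : Matrix (Fin n) (Fin n) F} (hA : C.Computes A) : (C.restrictGates s emb).Computes A := by
  classical
  obtain ⟨v, hv, hvA⟩ := hA
  -- gates outside the range compute zero
  have hzero : ∀ g, g ∉ Set.range emb → v g = 0 := by
    intro g hg
    obtain ⟨h1, h2⟩ := hout g hg
    rw [hv g]
    ext i
    simp only [Pi.add_apply, Finset.sum_apply, Pi.smul_apply, smul_eq_mul, h1 i, h2, zero_mul,
      Finset.sum_const_zero, add_zero, Pi.zero_apply]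
  -- reindexing sums over the gates of `C` by the slots
  have hsum : ∀ f : Fin m → F, (∀ g, g ∉ Set.range emb → f g = 0) →
      ∑ g, f g = ∑ t : Fin s, if h : t.val < k then f (emb ⟨t.val, h⟩) else 0 := by
    intro f hf
    rw [sum_fin_dite_eq hks (fun t => f (emb t))]
    have h1 : ∑ g ∈ Finset.univ.map emb.toEmbedding, f g = ∑ g, f g :=
      Finset.sum_subset (Finset.subset_univ _) fun g _ hg => hf g fun ⟨t, ht⟩ =>
        hg (Finset.mem_map.2 ⟨t, Finset.mem_univ _, ht⟩)
    rw [← h1, Finset.sum_map]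
    rfl
  refine ⟨fun t => if h : t.val < k then v (emb ⟨t.val, h⟩) else 0, fun t => ?_, fun j => ?_⟩
  · ext i
    simp only [Pi.add_apply, Finset.sum_apply, Pi.smul_apply, smul_eq_mul, restrictGates_inW,
      restrictGates_gateW]
    by_cases h : t.val < k
    · rw [dif_pos h, dif_pos h, hv]
      simp only [Pi.add_apply, Finset.sum_apply, Pi.smul_apply, smul_eq_mul]
      congr 1
      rw [hsum (fun g' => C.gateW (emb ⟨t.val, h⟩) g' * v g' i) fun g' hg' => by
        rw [hzero g' hg', Pi.zero_apply, mul_zero]]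
      refine Finset.sum_congr rfl fun t' _ => ?_
      by_cases h' : t'.val < k
      · rw [dif_pos h', dif_pos ⟨h, h'⟩, dif_pos h']
      · rw [dif_neg h', dif_neg (fun hh => h' hh.2), zero_mul]
    · rw [dif_neg h, dif_neg h, Pi.zero_apply, zero_add]
      symm
      refine Finset.sum_eq_zero fun t' _ => ?_
      rw [dif_neg (fun hh => h hh.1), zero_mul]
  · ext i
    have := congrFun (hvA j) i
    simp only [Pi.add_apply, Finset.sum_apply, Pi.smul_apply, smul_eq_mul] at this
    simp only [Pi.add_apply, Finset.sum_apply, Pi.smul_apply, smul_eq_mul, restrictGates_outW_inl,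
      restrictGates_outW_inr]
    rw [this]
    congr 1
    rw [hsum (fun g => C.outW j (Sum.inr g) * v g i) fun g hg => by
      rw [hzero g hg, Pi.zero_apply, mul_zero]]
    refine Finset.sum_congr rfl fun t _ => ?_
    by_cases h : t.val < k
    · rw [dif_pos h, dif_pos h, dif_pos h]
    · rw [dif_neg h, dif_neg h, zero_mul]

/-- **"Every directed acyclic graph with `s` edges … can be embedded in `G` as a subgraph"**, in
the tree's model: a matrix computed by a circuit of size `≤ s` (with any number of gates) is
computed by a circuit with exactly `s` gates and size `≤ s` — keep the gates with a nonzero incoming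
edge (at most `size ≤ s` of them; the others compute `0`), in their order, and pad with edge-less
gates. [cite: KumarVolk2022, Lemma 4.1 (proof)] -/
theorem _root_.Literature.Computability.AlgebraicComplexity.LinCircuit.exists_normalForm
    (C : LinCircuit F n m) {A : Matrix (Fin n) (Fin n) F} (hA : C.Computes A) {s : ℕ}
    (hs : C.size ≤ s) : ∃ C' : LinCircuit F n s, C'.size ≤ s ∧ C'.Computes A := by
  classical
  -- the gates with a nonzero incoming edge
  let fed : Finset (Fin m) :=
    Finset.univ.filter fun g => (∃ i, C.inW g i ≠ 0) ∨ ∃ g', C.gateW g g' ≠ 0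
  have hmem : ∀ g, g ∈ fed ↔ (∃ i, C.inW g i ≠ 0) ∨ ∃ g', C.gateW g g' ≠ 0 := fun g => by
    simp only [fed, Finset.mem_filter, Finset.mem_univ, true_and]
  -- there are at most `size C ≤ s` of them: each has an incoming edge of its own
  have hk : fed.card ≤ s := by
    refine le_trans ?_ hs
    have hle : Nat.card {g // g ∈ fed} ≤ Nat.card ({p : Fin m × Fin n // C.inW p.1 p.2 ≠ 0} ⊕
        {p : Fin m × Fin m // C.gateW p.1 p.2 ≠ 0}) := by
      let φ : {g // g ∈ fed} → {p : Fin m × Fin n // C.inW p.1 p.2 ≠ 0} ⊕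
          {p : Fin m × Fin m // C.gateW p.1 p.2 ≠ 0} := fun g =>
        if h : ∃ i, C.inW g.1 i ≠ 0 then Sum.inl ⟨(g.1, h.choose), h.choose_spec⟩
        else Sum.inr ⟨(g.1, (((hmem g.1).1 g.2).resolve_left h).choose),
          (((hmem g.1).1 g.2).resolve_left h).choose_spec⟩
      refine Nat.card_le_card_of_injective φ fun g₁ g₂ h => ?_
      by_cases h₁ : ∃ i, C.inW g₁.1 i ≠ 0 <;> by_cases h₂ : ∃ i, C.inW g₂.1 i ≠ 0
      · simp only [φ, dif_pos h₁, dif_pos h₂] at h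
        exact Subtype.ext (congrArg (fun p => p.1.1) (Sum.inl_injective h))
      · simp only [φ, dif_pos h₁, dif_neg h₂] at h
        exact absurd h Sum.inl_ne_inr
      · simp only [φ, dif_neg h₁, dif_pos h₂] at h
        exact absurd h Sum.inr_ne_inl
      · simp only [φ, dif_neg h₁, dif_neg h₂] at h
        exact Subtype.ext (congrArg (fun p => p.1.1) (Sum.inr_injective h))
    rw [Nat.card_eq_finsetCard, Nat.card_sum] at hle
    unfold LinCircuit.size
    omega
  let emb : Fin fed.card ↪o Fin m := fed.orderEmbOfFin rfl
  refine ⟨C.restrictGates s emb, (size_restrictGates_le C s emb).trans hs,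
    restrictGates_computes C s emb hk (fun g hg => ?_) hA⟩
  rw [Finset.range_orderEmbOfFin, Finset.mem_coe, hmem] at hg
  push Not at hg
  exact hg

end NormalForm

section UniversalMap

variable {K : Type*} [Field K] {n s : ℕ}

/-- **The universal map `U(x, y)` for size-`s` linear circuits** (KV §4.1): the matrix computed by
the universal circuit whose edge slots `e` are labelled by the coordinates `SV_{s',s}(x, y)_e` of
the Shpilka–Volkovich map (Lemma 3.1, `KumarVolk2020.svMap`, distinct nodes `a : USlot n s ↪ K`),
entry `p = (j, i)`; variables `x = inl`, `y = inr` of `Fin s ⊕ Fin s`. [cite: KumarVolk2022, §4.1] -/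
def universalMap (a : USlot n s ↪ K) (p : Fin n × Fin n) : MvPolynomial (Fin s ⊕ Fin s) K :=
  ucOut (fun e => svMap a s e) p.1 p.2

/-- **"The degree of `U` is at most `s'·(s+1)`"** with `s' = |USlot n s| = sn + s² + n(n+s)`.
[cite: KumarVolk2022, Lemma 4.1] -/
theorem totalDegree_universalMap_le (a : USlot n s ↪ K) (p : Fin n × Fin n) :
    (universalMap a p).totalDegree ≤ (s * n + (s * s + n * (n + s))) * (s + 1) := by
  classical
  rw [← card_uSlot]
  exact totalDegree_ucOut_le _ (fun e => totalDegree_svMap_le a s e) p.1 p.2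

/-- **The Shpilka–Volkovich step** ("it is possible to set the tuple of variables `y` to field
elements `α_1, …, α_s` such that the `j`-th coordinate of `SV(x, α)` equals `β_i` if `j = i_k` for
some `1 ≤ k ≤ s` [and] `0` otherwise"): every labelling `β` of the slots with at most `s` nonzero
labels is `SV_{s',s}(x, α)` for some `(x, α)`. [cite: KumarVolk2022, Lemma 4.1 (proof)] -/
theorem exists_eval_svMap_eq (a : USlot n s ↪ K) (β : USlot n s → K)
    (hβ : Nat.card {e // β e ≠ 0} ≤ s) :
    ∃ γ : Fin s ⊕ Fin s → K, ∀ e, eval γ (svMap a s e) = β e := by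
  classical
  -- the support, padded to size exactly `s`, enumerated
  set supp : Finset (USlot n s) := Finset.univ.filter fun e => β e ≠ 0 with hsupp
  have hcard : supp.card ≤ s := by
    have h : Nat.card {e // β e ≠ 0} = supp.card :=
      Nat.subtype_card supp fun e => by simp [hsupp]
    rw [← h]
    exact hβ
  have hsU : s ≤ Fintype.card (USlot n s) := by
    rw [card_uSlot]
    exact (Nat.le_mul_self s).trans (Nat.le_add_right _ _ |>.trans (Nat.le_add_left _ _))
  obtain ⟨T, hT, hTcard⟩ := Finset.exists_superset_card_eq hcard hsU
  let π : Fin s → USlot n s := fun t => (T.equivFin.symm (Fin.cast hTcard.symm t) : USlot n s)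
  have hπinj : Function.Injective π := fun t t' h => by
    have := Subtype.ext h
    simpa [π] using this
  have hπT : ∀ e, β e ≠ 0 → e ∈ Set.range π := fun e he =>
    ⟨Fin.cast hTcard (T.equivFin ⟨e, hT (by simp [hsupp, he])⟩), by simp [π]⟩
  let πe : Fin s ↪ USlot n s := ⟨π, hπinj⟩
  refine ⟨Sum.elim (fun t => β (π t)) (fun t => a (π t)), fun e => ?_⟩
  by_cases he : e ∈ Set.range π
  · obtain ⟨t, rfl⟩ := he
    exact eval_svMap_apply a πe (fun t => β (π t)) t
  · rw [eval_svMap_of_not_mem_range a π _ he]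
    by_contra hne
    exact he (hπT e (Ne.symm hne))

/-- **Image of the universal map** ("Observe that under this labeling of the edges, the circuit `G`
computes the same transformation as the circuit `C`. Hence `U(x, α) = A`."): the matrix computed by
the universal circuit under any labelling with at most `s` nonzero labels is in the image of `U`.
[cite: KumarVolk2022, Lemma 4.1 (proof)] -/
theorem ucOut_mem_polyMapImage_universalMap (a : USlot n s ↪ K) (β : USlot n s → K)
    (hβ : Nat.card {e // β e ≠ 0} ≤ s) :
    (fun p : Fin n × Fin n => ucOut β p.1 p.2) ∈ polyMapImage (universalMap a) := by
  obtain ⟨γ, hγ⟩ := exists_eval_svMap_eq a β hβ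
  refine ⟨γ, funext fun p => ?_⟩
  change eval γ (ucOut (fun e => svMap a s e) p.1 p.2) = ucOut β p.1 p.2
  rw [map_ucOut]
  simp only [hγ]

/-- **The circuit side of Lemma 4.1**: a point of `smallLinCircuitSet F n s` (a matrix with a linear
circuit of size `≤ s`) is the matrix computed by the universal circuit under a labelling with at
most `s` nonzero labels — namely the labels of its normal form with exactly `s` gates.
[cite: KumarVolk2022, Lemma 4.1 (proof)] -/
theorem exists_labels_of_mem_smallLinCircuitSet {F : Type*} [Field F] {x : Fin n × Fin n → F}
    (hx : x ∈ smallLinCircuitSet F n s) :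
    ∃ β : USlot n s → F, Nat.card {e // β e ≠ 0} ≤ s ∧ ∀ j i, ucOut β j i = x (j, i) := by
  obtain ⟨m, C, hsize, hA⟩ := hx
  obtain ⟨C', hsize', hA'⟩ := C.exists_normalForm hA hsize
  refine ⟨labels C', (card_labels_ne_zero C').le.trans hsize', fun j i => ?_⟩
  rw [ucOut_labels_eq C' hA', matrixOfPt_apply]

/-- **Lemma 4.1 for the universal map `universalMap a`** (any field with `|USlot n s|` distinct
nodes `a`): `smallLinCircuitSet F n s ⊆ Im U`. [cite: KumarVolk2022, Lemma 4.1] -/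
theorem smallLinCircuitSet_subset_polyMapImage_universalMap (a : USlot n s ↪ K) :
    smallLinCircuitSet K n s ⊆ polyMapImage (universalMap a) := by
  intro x hx
  obtain ⟨β, hβ, hx⟩ := exists_labels_of_mem_smallLinCircuitSet hx
  have : x = fun p : Fin n × Fin n => ucOut β p.1 p.2 := funext fun p => (hx p.1 p.2).symm
  rw [this]
  exact ucOut_mem_polyMapImage_universalMap a β hβ

/-- The slot count under Lemma 4.1's hypotheses: `sn + s² + n(n+s) ≤ 4s² ≤ s⁴` for `n ≤ s`,
`2 ≤ s` (print: "`s' ≤ s⁴`"). [cite: KumarVolk2022, §4.1] -/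
theorem card_uSlot_le_pow_four (hns : n ≤ s) (hs : 2 ≤ s) :
    s * n + (s * s + n * (n + s)) ≤ s ^ 4 := by
  have h1 : s * n ≤ s * s := Nat.mul_le_mul_left _ hns
  have h2 : n * (n + s) ≤ 2 * (s * s) := by
    calc n * (n + s) ≤ s * (s + s) := Nat.mul_le_mul hns (Nat.add_le_add_right hns _)
      _ = 2 * (s * s) := by ring
  have h3 : 4 * (s * s) ≤ s ^ 4 := by
    have h4 : 4 ≤ s * s := by nlinarith
    calc 4 * (s * s) ≤ (s * s) * (s * s) := Nat.mul_le_mul_right _ h4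
      _ = s ^ 4 := by ring
  omega

end UniversalMap

section Descent

variable {F K : Type*} [Field F] [Field K] [Algebra F K] {ι : Type*}

/-- **Descent of equations along a field extension** `K ⊇ F`: a nonzero `Q ∈ K[y_ι]` vanishing at
all points of `S ⊆ F^ι` yields a nonzero `Q' ∈ F[y_ι]` of no larger degree vanishing on `S` — a
nonzero coordinate of `Q`, coefficientwise, with respect to an `F`-basis of `K` (for `x ∈ F^ι`,
`Q(x) = Σ_b Q_b(x) · b` with `Q_b(x) ∈ F`). Used to remove the field-size bookkeeping from
Theorem 1.2. [folklore] -/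
private theorem exists_isEquationFor_of_extension (S : Set (ι → F)) (Q : MvPolynomial ι K) (hQ0 : Q ≠ 0)
    (hQ : ∀ x ∈ S, eval (fun i => algebraMap F K (x i)) Q = 0) :
    ∃ Q' : MvPolynomial ι F, IsEquationFor S Q' ∧ Q'.totalDegree ≤ Q.totalDegree := by
  classical
  let b := Module.Free.chooseBasis F K
  obtain ⟨m₀, hm₀⟩ := ne_zero_iff.1 hQ0
  obtain ⟨idx, hidx⟩ : ∃ idx, b.repr (coeff m₀ Q) idx ≠ 0 := by
    by_contra h
    push Not at h
    refine hm₀ (b.repr.map_eq_zero_iff.1 (Finsupp.ext fun i => ?_))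
    rw [Finsupp.zero_apply]
    exact h i
  let Q' : MvPolynomial ι F := ∑ m ∈ Q.support, monomial m (b.repr (coeff m Q) idx)
  have hcoeff : ∀ m, coeff m Q' = if m ∈ Q.support then b.repr (coeff m Q) idx else 0 := by
    intro m
    simp only [Q', coeff_sum, coeff_monomial]
    rw [Finset.sum_ite_eq' Q.support m]
  have hsub : Q'.support ⊆ Q.support := by
    intro d hd
    rw [mem_support_iff, hcoeff] at hd
    by_contra h
    exact hd (if_neg h)
  refine ⟨Q', ⟨fun h => ?_, fun x hx => ?_⟩, ?_⟩
  · -- `Q' ≠ 0`: its `m₀`-coefficient is the chosen nonzero coordinate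
    have := hcoeff m₀
    rw [h, coeff_zero, if_pos (mem_support_iff.2 hm₀)] at this
    exact hidx this.symm
  · -- `Q'` vanishes on `S`: apply the `idx`-coordinate to `Q(x) = 0`
    have hK := hQ x hx
    rw [eval_eq] at hK
    have hlin : b.repr (∑ d ∈ Q.support, coeff d Q * ∏ i ∈ d.support, algebraMap F K (x i) ^ d i) idx =
        ∑ d ∈ Q.support, b.repr (coeff d Q) idx * ∏ i ∈ d.support, x i ^ d i := by
      rw [map_sum, Finset.sum_apply']
      refine Finset.sum_congr rfl fun d _ => ?_
      have hprod : (∏ i ∈ d.support, algebraMap F K (x i) ^ d i) =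
          algebraMap F K (∏ i ∈ d.support, x i ^ d i) := by
        rw [map_prod]
        simp only [map_pow]
      rw [hprod, mul_comm, ← Algebra.smul_def, map_smul, Finsupp.smul_apply, smul_eq_mul, mul_comm]
    rw [hK, map_zero, Finsupp.zero_apply] at hlin
    rw [eval_eq, Finset.sum_subset hsub (fun d _ hd => by rw [notMem_support_iff.1 hd, zero_mul])]
    refine Eq.trans (Finset.sum_congr rfl fun d hd => ?_) hlin.symm
    rw [hcoeff, if_pos hd]
  · -- degree
    refine totalDegree_finsetSum_le fun m hm => ?_
    calc (monomial m (b.repr (coeff m Q) idx)).totalDegree ≤ m.sum (fun _ => id) :=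
          totalDegree_monomial_le _ _
      _ = m.sum (fun _ e => e) := rfl
      _ ≤ Q.totalDegree := le_totalDegree hm

end Descent

section Count

/-- **The count of Theorem 1.2**, every `n ≥ 1` (in place of print's "`binom(n²+n³, n²) ≥ n^{n²}`
whereas `dim V₂ ≤ (2n^{30})^{n²/100} < dim V₁`"): with `200 s ≤ n²` and
`D = (sn + s² + n(n+s))(s+1)` (the degree of `U`), `binom(2s + D n³, 2s) < binom(n² + n³, n²)` —
`D n³ + 1 ≤ (n+1)^{13}` and `13 · 2s < n²`. [cite: KumarVolk2022, Thm. 1.2 (proof)] -/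
theorem thm_1_2_count {n s : ℕ} (hn : 1 ≤ n) (hs : 200 * s ≤ n ^ 2) :
    (s + s + (s * n + (s * s + n * (n + s))) * (s + 1) * n ^ 3).choose (s + s) <
      (n * n + n ^ 3).choose (n * n) := by
  have hn2 : n ^ 2 = n * n := sq n
  have hsn : s ≤ n ^ 2 := by omega
  have hnn : n ≤ n ^ 2 := by rw [hn2]; exact Nat.le_mul_self n
  have h1 : s * n ≤ n ^ 4 :=
    calc s * n ≤ n ^ 2 * n ^ 2 := Nat.mul_le_mul hsn hnn
      _ = n ^ 4 := by ring
  have h2 : s * s ≤ n ^ 4 :=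
    calc s * s ≤ n ^ 2 * n ^ 2 := Nat.mul_le_mul hsn hsn
      _ = n ^ 4 := by ring
  have h3 : n * (n + s) ≤ 2 * n ^ 4 :=
    calc n * (n + s) ≤ n ^ 2 * (n ^ 2 + n ^ 2) := Nat.mul_le_mul hnn (Nat.add_le_add hnn hsn)
      _ = 2 * n ^ 4 := by ring
  have h4 : s + 1 ≤ 2 * n ^ 2 := by
    have : 1 ≤ n ^ 2 := Nat.one_le_pow _ _ hn
    omega
  have hD : (s * n + (s * s + n * (n + s))) * (s + 1) ≤ 8 * n ^ 6 :=
    calc (s * n + (s * s + n * (n + s))) * (s + 1) ≤ (4 * n ^ 4) * (2 * n ^ 2) :=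
          Nat.mul_le_mul (by omega) h4
      _ = 8 * n ^ 6 := by ring
  have e1 : 8 ≤ (n + 1) ^ 3 :=
    calc 8 = 2 ^ 3 := rfl
      _ ≤ (n + 1) ^ 3 := Nat.pow_le_pow_left (by omega) 3
  have e2 : n ^ 9 ≤ (n + 1) ^ 9 := Nat.pow_le_pow_left (Nat.le_succ n) 9
  have e3 : 1 ≤ n ^ 9 := Nat.one_le_pow _ _ hn
  have hM : (s * n + (s * s + n * (n + s))) * (s + 1) * n ^ 3 + 1 ≤ (n + 1) ^ 13 :=
    calc (s * n + (s * s + n * (n + s))) * (s + 1) * n ^ 3 + 1 ≤ 8 * n ^ 6 * n ^ 3 + 1 :=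
          Nat.add_le_add_right (Nat.mul_le_mul_right _ hD) _
      _ = 8 * n ^ 9 + 1 := by ring
      _ ≤ 8 * n ^ 9 * 2 := by omega
      _ ≤ (n + 1) ^ 3 * (n + 1) ^ 9 * (n + 1) :=
          Nat.mul_le_mul (Nat.mul_le_mul e1 e2) (by omega)
      _ = (n + 1) ^ 13 := by ring
  have hK : 13 * (s + s) < n * n := by
    have : 0 < n * n := Nat.mul_pos hn hn
    omega
  have hm : n * (n * n) ≤ n ^ 3 := le_of_eq (by ring)
  rw [Nat.add_comm (n * n) (n ^ 3)]
  exact choose_lt_choose_of_pow hM hK hn hm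

end Count

end KumarVolk2020

/-- **Kumar–Volk, Lemma 4.1 — DISCHARGED** by the printed construction in the tree's layered model:
the universal circuit with `s` gate slots and `s' = sn + s² + n(n+s) ≤ s⁴` edge slots labelled by
`SV_{s',s}(x, y)` (`KumarVolk2020.universalMap`, nodes from the given `s⁴ + 1` distinct field
elements), degree `≤ s'(s+1) ≤ s⁴(s+1)`; a size-`≤ s` circuit is put in normal form with exactly
`s` gates (`LinCircuit.exists_normalForm`), its `≤ s` labels are realised by a value of `y`
(`KumarVolk2020.exists_eval_svMap_eq`), and the universal circuit then computes its matrix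
(`KumarVolk2020.ucOut_labels_eq`). The hypothesis `4 ≤ s` is used only as `2 ≤ s`.
[cite: KumarVolk2022, Lemma 4.1] -/
theorem kumarVolk2020_lem_4_1_holds : kumarVolk2020_lem_4_1 := by
  intro F _ n s hns hs4 ⟨e⟩
  have hcard : Fintype.card (KumarVolk2020.USlot n s) ≤ s ^ 4 + 1 := by
    rw [KumarVolk2020.card_uSlot]
    exact (KumarVolk2020.card_uSlot_le_pow_four hns (le_trans (by norm_num) hs4)).trans (Nat.le_succ _)
  let a : KumarVolk2020.USlot n s ↪ F :=
    (Fintype.equivFin (KumarVolk2020.USlot n s)).toEmbedding.trans ((Fin.castLEEmb hcard).trans e)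
  refine ⟨KumarVolk2020.universalMap a, fun p => ?_,
    KumarVolk2020.smallLinCircuitSet_subset_polyMapImage_universalMap a⟩
  refine (KumarVolk2020.totalDegree_universalMap_le a p).trans (Nat.mul_le_mul_right _ ?_)
  exact KumarVolk2020.card_uSlot_le_pow_four hns (le_trans (by norm_num) hs4)


/-- **Kumar–Volk, Theorem 1.2 — DISCHARGED**, with threshold `n₀ = 1` and for EVERY field: the
universal map of Lemma 4.1 (`KumarVolk2020.universalMap`) for `s = ⌊n²/200⌋`, the dimension count of
Lemma 2.1 (`KumarVolk2020.exists_isEquationFor_polyMapImage`, `N = n²`, `K = 2s`,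
`D = (sn + s² + n(n+s))(s+1)`, `Δ = n³`; exact count `KumarVolk2020.thm_1_2_count`), and a descent.
PRINT-READING NOTE (a gap in the printed proof, closed here): Theorem 1.2 assumes "`F` of size at
least `n²`", but the printed proof labels the `s' ≤ n⁸` edges of the universal graph by the
coordinates of `SV_{s',s}`, whose Lagrange nodes need `|F| > s'` (Lemma 3.1) — more than `n²`
elements for large `n`. The tree's proof runs the printed argument over the algebraic closure
`K ⊇ F` (infinite, so the nodes exist) — a matrix over `F` with a small circuit over `F` is, read in
`K`, in the image of `U` (`KumarVolk2020.exists_labels_of_mem_smallLinCircuitSet`,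
`KumarVolk2020.map_ucOut`) — and descends the equation to `F` coefficientwise along an `F`-basis of
`K` (`KumarVolk2020.exists_isEquationFor_of_extension`). Consequently the typed field-size
hypothesis is not used, and nothing is weakened. [cite: KumarVolk2022, Thm. 1.2] -/
theorem kumarVolk2020_thm_1_2_holds : kumarVolk2020_thm_1_2 := by
  refine ⟨1, fun n hn F _ _ => ?_⟩
  classical
  set s := n ^ 2 / 200 with hs
  have hs200 : 200 * s ≤ n ^ 2 := Nat.mul_div_le (n ^ 2) 200
  let K := AlgebraicClosure F
  -- distinct nodes for the edge slots, in the infinite field `K`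
  let a : KumarVolk2020.USlot n s ↪ K :=
    (Fintype.equivFin _).toEmbedding.trans (Fin.valEmbedding.trans (Infinite.natEmbedding K))
  -- Lemma 2.1 over `K` for the universal map
  obtain ⟨QK, hQK, hdeg⟩ := KumarVolk2020.exists_isEquationFor_polyMapImage
    (KumarVolk2020.universalMap a) (D := (s * n + (s * s + n * (n + s))) * (s + 1)) (Δ := n ^ 3)
    (fun p => KumarVolk2020.totalDegree_universalMap_le a p) (by
      simp only [Fintype.card_sum, Fintype.card_fin, Fintype.card_prod]
      exact KumarVolk2020.thm_1_2_count hn hs200)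
  -- descend to `F`
  obtain ⟨Q, hQ, hQdeg⟩ := KumarVolk2020.exists_isEquationFor_of_extension
    (smallLinCircuitSet F n s) QK hQK.1 (fun x hx => by
      -- an `F`-point with a small circuit over `F`, read in `K`, lies in the image of `U`
      obtain ⟨β, hβ, hβx⟩ := KumarVolk2020.exists_labels_of_mem_smallLinCircuitSet hx
      have hβK : Nat.card {e // algebraMap F K (β e) ≠ 0} ≤ s := by
        rwa [Nat.card_congr (Equiv.subtypeEquivRight fun e =>
          map_ne_zero_iff (algebraMap F K) (algebraMap F K).injective)]
      have hmem := KumarVolk2020.ucOut_mem_polyMapImage_universalMap a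
        (fun e => algebraMap F K (β e)) hβK
      have hxK : (fun p : Fin n × Fin n => algebraMap F K (x p)) =
          fun p => KumarVolk2020.ucOut (fun e => algebraMap F K (β e)) p.1 p.2 := by
        funext p
        rw [← KumarVolk2020.map_ucOut (algebraMap F K) β p.1 p.2, hβx p.1 p.2]
      rw [hxK]
      exact hQK.2 _ hmem)
  exact ⟨Q, hQ, hQdeg.trans hdeg⟩

end Literature.Computability.AlgebraicComplexity

end
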